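import Literature.NumberTheory.Rogawski1990.CMCharIdentityClauses
import Literature.NumberTheory.GelbartRogawski1991.WeilLiftNonsplitPrincipalSeriesConstituent
import HarnessLib

/-!
# [Rogawski1990 Prop. 13.1.3 (d), 13.1.4; GelbartRogawski1991 Lem. 5.1.2] THE THETA-DOCKING CLAUSE of the joint transfer letter — «the supercuspidal member
# `πˢ(ξ_v)` pinned by the character identity (13.1.4) IS a `U(1)`-theta type `X_v(μ, ε, χ_f)`» — AS A PREDICATE ON GIVEN DATA (node N9 of topic T7)

Topic `NumberTheory/Rogawski1990`; namespace `Literature.NumberTheory.Rogawski1990`.  DEFINITIONS WITH BODY ONLY (two `Prop`-valued predicates on GIVEN global data,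
in the exact binder currency of ★ `CMCharIdentityClauses` ∕ ★ `CMCharIdentityPackage`) + their `Iff.rfl` unfoldings and one read-back; **no named fact (debt 0), no
instance, no notation, no attribute, no `sorry`; this file ASSERTS NOTHING.**  Cell `hodgecm-mathlib` (D-0151), crux H413; topic T7 of director g16's
PLAN-THROUGHPUT-P2-P5 §4 (seat typ-T7b; map `F0/P2/T7b-TREE.md` node N9 «docking»).  HC_CM is proved only modulo the printed citations («named inputs remaining 2») until
rung 0 closes; nothing here proves anything.

WHY A CLAUSE AND NOT A FREE-STANDING LETTER (the Δ-twist caveat of ★ `CMCharIdentityClauses` ∕ RULING (V29), applied to theta docking).  Print: at a non-split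
finite `v`, Rogawski's A-packet `Π(ξ_v) = {πⁿ(ξ_v), πˢ(ξ_v)}` [§13.1 p. 199], `πˢ(ξ_v)` being THE supercuspidal representation with `ξ_H(St_H(ξ)) = {π²(ξ), πˢ(ξ)}`
[Prop. 13.1.3 (d)] — i.e. pinned by the character identity `χ_ξ(f^H) = χ_{πⁿ}(f) + χ_{πˢ}(f)` [Prop. 13.1.4] for Rogawski's transfer `f ↦ f^H` — and [GelbartRogawski1991
Lem. 5.1.2 p. 466] «`Π(ϱ_v) = {ω(γ_v, ψ_v, χ_v)}`, where `ψ_v` ranges over a set of representatives for additive characters modulo `N_{E/F}(E_v*)`»: so `πˢ(ξ_v)` IS the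
local theta type `X_v(μ, ε, χ_f)` of the non-occurring line class (printed proof GLOBAL: Thm. 5.1.1 + [Rogawski1992 Thm. 1.1] + multiplicity one).  In the tree `πˢ(ξ_v)`
exists only as the existential witness of ★ `CMNonsplitCharIdentityAt … πⁿ` for GIVEN transfer data `(Δ_v, m_{H,v}, m_{G,v}, ν_{G,v}, ν_{H,v}, ξ_v)`; for a twisted or
degenerate `Δ` the witnesses of that predicate are NOT print's `πˢ(ξ_v)` (they are `πˢ((ξθ⁻¹)_v)`, or arbitrary when the matching relation is too small), and
«every supercuspidal witness is a `(μ, χ_f)`-theta type» would then be FALSE.  Hence the docking statement is typed, exactly like the identities themselves, as a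
PREDICATE `CMThetaDockingClauses … Δ mH mG νH νG ξ μω ξloc e₁ dV … g hg` on given data, to be CONJOINED to the joint existential of ★
`GlobalTransferWithCMCharIdentities` (★ `GlobalTransferWithStabilisationPackageAnd` at `Q := CMCharIdentityPackage ∧ CMThetaDockingPackage`) by the owner of that letter
(F0P3b ∕ T4), where it is print-true: for Rogawski's canonical data the supercuspidal completing `πⁿ(ξ_v)` in (13.1.4) is unique (linear independence of characters) and
is the theta type (GR91 Lem. 5.1.2).  Consumers (the pay-down of letter #75 D7α ★ `GelbartRogawski1991.xiEnvelope_nonsplit_isThetaType`): the GLOBAL half ends at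
«`P_v ∈ {πⁿ(ξ_v) ∘ e, πs}` with `πs` the identity's witness» and this clause turns `πs` into `∃ ε, ThetaTypeAtCM … ε v πs`; the member `πⁿ` is served by the sibling
letter ★-pending `GelbartRogawski1991.xiLocalPacket_nonsplit_isThetaPair` (T7 root, p826161).

* `CMThetaDockingClauses L H Δ mH mG νH νG ξ μω ξloc e₁ dV hdV hdV0 g hg` — for the global transfer data, Haar families, `ξ`, `μω`, local characters `ξloc`
  AND a rational theta frame `ᵗ(c̄ g) H g = diag dV` (★ `ThetaTypeAtCM`'s binders): for every pair `(μ, χ_f)` on the two DICTIONARY equations of letter #76 (verbatim), at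
  every NON-SPLIT finite `v`, every form congruence `e`, every Haar `μZ` on `U(Φ₃)(L⁺_v) ⧸ Z`, every Keys-labelled pair `(π², πⁿ)` of `JH(i_G(χ_ξ))` (★ `KeysCaseTwoLabels`)
  with `πⁿ` NOT square-integrable, and EVERY supercuspidal class `πs ≠ πⁿ ∘ e` of `U(H)(L⁺_v)` satisfying (13.1.4) jointly with `πⁿ ∘ e` (★ `LocalAPacket.CharIdentityAt`,
  `tr := IrrClass.smoothTrace (ν_G v)`): `πs` is the theta type `X_v(μ, ε, χ_f) ∘ κ_v⁻¹` for some line class `ε`.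
* `CMThetaDockingPackage L H νH νG μω e₁ dV hdV hdV0 g hg : (Δ_v)_v → (m_{H,v})_v → (m_{G,v})_v → Prop` — the `Q`-shaped package: `∀ ξ`, the clauses at
  `ξloc := ξ.xiLocalChar` BY NAME (the currency of ★ `CMCharIdentityPackage`).
* `cmThetaDockingClauses_iff`, `cmThetaDockingPackage_iff` (`Iff.rfl`); read-back `CMThetaDockingPackage.clauses`.

## References
* [Rogawski1990] J. Rogawski, *Automorphic Representations of Unitary Groups in Three Variables*, Ann. of Math. Stud. 123 (1990): §12.2 (2) p. 174; §13.1 p. 199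
  (Prop. 13.1.3 (d), Prop. 13.1.4, the A-packet `Π(ξ)`); §4.9 pp. 54–55 (transfer factor through `μ`).
* [GelbartRogawski1991] S. Gelbart, J. Rogawski, Invent. Math. 105 (1991): §1.4 pp. 450–451; Lem. 5.1.2 p. 466 (+ its GLOBAL proof); Remark p. 466.
* [Rogawski1992] J. Rogawski, *The multiplicity formula for A-packets*, CRM Montréal (1992) 395–419: Thm. 1.1 p. 396.
* [GelbartRogawski1990] S. Gelbart, J. Rogawski, Israel Math. Conf. Proc. 2 (1990) 19–75: Prop. 5.2.2 (as recalled in [GelbartRogawski1991] p. 467).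
-/

set_option autoImplicit false

noncomputable section

open NumberField IsDedekindDomain MeasureTheory
open scoped Matrix ComplexOrder

namespace Literature.NumberTheory.Rogawski1990

open Literature.NumberTheory Literature.NumberTheory.Automorphic Literature.NumberTheory.Automorphic.UnitaryGroup
open Literature.NumberTheory.Automorphic.IdeleClassGroup
open Literature.NumberTheory.Automorphic.Liu2021 Literature.NumberTheory.Automorphic.Liu2021.Def411WeilCarriers
open Literature.NumberTheory.GaloisRepresentations
open Literature.NumberTheory.GelbartRogawski1991

section Clauses

variable (L : Type) [Field L] [NumberField L] [IsCMField L] (H : Matrix (Fin 3) (Fin 3) L)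
  (hH : (H.map (cmConjRingHom L))ᵀ = H) (hHd : IsUnit H.det)

set_option synthInstance.maxHeartbeats 400000 in
set_option maxHeartbeats 8000000 in
/-- **The theta-docking clause of the joint letter [Rogawski1990 Prop. 13.1.3 (d), 13.1.4; GelbartRogawski1991 Lem. 5.1.2] on GIVEN data.**  For the global transfer data
`(Δ_v, m_{H,v}, m_{G,v})_v`, Haar families `ν_H, ν_G`, the character `ξ` of `H`, Rogawski's `μ = μω`, the local characters `ξ_v = ξloc v`, and a rational theta frame
`ᵗ(c̄ g) H g = diag dV`: for every pair `(μ, χ_f)` (`μ` conjugate-symplectic, `χ_f` a continuous unitary character of `U(1)(𝔸_{L⁺,f})`) on letter #76's two DICTIONARY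
equations, at every finite `v` of `L⁺` that does not split in `L`, for every form congruence `ᵗT̄·H_v·T = a·Φ₃`, every Haar measure `μZ` on `U(Φ₃)(L⁺_v) ⧸ Z`, every
Keys-labelled pair `(π², πⁿ)` of `JH(i_G(χ_ξ))` with `πⁿ` NOT square-integrable (so `πⁿ = πⁿ(ξ_v)`), and every SUPERCUSPIDAL class `πs ≠ πⁿ ∘ e` of `U(H)(L⁺_v)` such that
the packet `⟨πⁿ ∘ e, some πs⟩` satisfies the character identity (13.1.4) for this data: `πs` is the local theta type `X_v(μ, ε, χ_f) ∘ κ_v⁻¹` (★ `ThetaTypeAtCM`) for some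
line class `ε` — «`πˢ(ξ_v) = ω(γ_v, ψ′_v, χ_v)` for the other class of `ψ′_v`».  A PREDICATE: print-true for Rogawski's canonical transfer data (where the witness `πs` is
unique and is GR91's supercuspidal Weil representation), meaningless for twisted∕degenerate `Δ` — to be asserted only INSIDE the joint existential of ★
`GlobalTransferWithCMCharIdentities` (its owner's edition), never free-standing.
[cite: Rogawski1990, §13.1 Prop. 13.1.3 (d), Prop. 13.1.4 p. 199; §12.2 (2) p. 174] [cite: GelbartRogawski1991, Lem. 5.1.2 p. 466; §1.4 pp. 450–451] -/
def CMThetaDockingClauses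
    [∀ v : HeightOneSpectrum (𝓞 ↥(maximalRealSubfield L)), MeasurableSpace ((cmDatum L 3 H).Local v)]
    [∀ v : HeightOneSpectrum (𝓞 ↥(maximalRealSubfield L)),
      MeasurableSpace ((cmDatum L 2 (Matrix.of fun i j : Fin 2 => if i.val + j.val + 1 = 2 then (1 : L) else 0)).Local v ×
        (cmDatum L 1 (Matrix.of fun i j : Fin 1 => if i.val + j.val + 1 = 1 then (1 : L) else 0)).Local v)]
    [∀ (v : HeightOneSpectrum (𝓞 ↥(maximalRealSubfield L)))
        (a : ((cmDatum L 2 (Matrix.of fun i j : Fin 2 => if i.val + j.val + 1 = 2 then (1 : L) else 0)).Local v ×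
          (cmDatum L 1 (Matrix.of fun i j : Fin 1 => if i.val + j.val + 1 = 1 then (1 : L) else 0)).Local v)),
      MeasurableSpace (((cmDatum L 2 (Matrix.of fun i j : Fin 2 => if i.val + j.val + 1 = 2 then (1 : L) else 0)).Local v ×
          (cmDatum L 1 (Matrix.of fun i j : Fin 1 => if i.val + j.val + 1 = 1 then (1 : L) else 0)).Local v) ⧸
        Subgroup.centralizer ({a} : Set ((cmDatum L 2 (Matrix.of fun i j : Fin 2 => if i.val + j.val + 1 = 2 then (1 : L) else 0)).Local v ×
          (cmDatum L 1 (Matrix.of fun i j : Fin 1 => if i.val + j.val + 1 = 1 then (1 : L) else 0)).Local v)))]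
    [∀ (v : HeightOneSpectrum (𝓞 ↥(maximalRealSubfield L))) (γ : (cmDatum L 3 H).Local v),
      MeasurableSpace ((cmDatum L 3 H).Local v ⧸ Subgroup.centralizer ({γ} : Set ((cmDatum L 3 H).Local v)))]
    (Δ : ∀ v : HeightOneSpectrum (𝓞 ↥(maximalRealSubfield L)), LocalTransferFactor L H v)
    (mH : ∀ v : HeightOneSpectrum (𝓞 ↥(maximalRealSubfield L)),
      OrbitalMeasureFamily ((cmDatum L 2 (Matrix.of fun i j : Fin 2 => if i.val + j.val + 1 = 2 then (1 : L) else 0)).Local v ×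
        (cmDatum L 1 (Matrix.of fun i j : Fin 1 => if i.val + j.val + 1 = 1 then (1 : L) else 0)).Local v))
    (mG : ∀ v : HeightOneSpectrum (𝓞 ↥(maximalRealSubfield L)), OrbitalMeasureFamily ((cmDatum L 3 H).Local v))
    (νH : ∀ v : HeightOneSpectrum (𝓞 ↥(maximalRealSubfield L)),
      Measure ((cmDatum L 2 (Matrix.of fun i j : Fin 2 => if i.val + j.val + 1 = 2 then (1 : L) else 0)).Local v ×
        (cmDatum L 1 (Matrix.of fun i j : Fin 1 => if i.val + j.val + 1 = 1 then (1 : L) else 0)).Local v))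
    (νG : ∀ v : HeightOneSpectrum (𝓞 ↥(maximalRealSubfield L)), Measure ((cmDatum L 3 H).Local v))
    (ξ : OneDimAutRepH L) (μω : HeckeCharacter L)
    (ξloc : ∀ v : HeightOneSpectrum (𝓞 ↥(maximalRealSubfield L)),
      (cmDatum L 2 (Matrix.of fun i j : Fin 2 => if i.val + j.val + 1 = 2 then (1 : L) else 0)).Local v ×
        (cmDatum L 1 (Matrix.of fun i j : Fin 1 => if i.val + j.val + 1 = 1 then (1 : L) else 0)).Local v →* ℂˣ)
    {n' : ℕ} (e₁ : Fin 3 × Fin 1 ≃ Fin n') (dV : Fin 3 → L) (hdV : ∀ i, IsCMField.complexConj L (dV i) = dV i) (hdV0 : ∀ i, dV i ≠ 0) (g : GL (Fin 3) L)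
    (hg : ((g : Matrix (Fin 3) (Fin 3) L).map (cmConjRingHom L))ᵀ * H * (g : Matrix (Fin 3) (Fin 3) L) = Matrix.diagonal dV) : Prop :=
  ∀ (μ : Literature.NumberTheory.Automorphic.IdeleClassGroup L →ₜ* Circle) (hμ : IsConjugateSymplectic L μ)
    (χf : UnitaryGroup.finAdelicOne (↥(maximalRealSubfield L)) L (IsCMField.complexConj L) →* ℂˣ),
    Continuous χf → (∀ z, ‖((χf z : ℂˣ) : ℂ)‖ = 1) →
    -- DICTIONARY (μ): `μ̃ = η̃⁻¹ · ψ̃⁻¹ · μω`, semi-locally at every finite place of `L⁺` (verbatim from #76)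
    (∀ v : HeightOneSpectrum (𝓞 ↥(maximalRealSubfield L)),
        (toHeckeCharacter L μ).semilocalComponent L v = (ξ.bcη⁻¹ * ξ.bcψ⁻¹ * μω).semilocalComponent L v) →
    -- DICTIONARY (χ_f): `χ_f (z / z̄) = (ψ̃⁻¹ · (η̃⁻¹ ψ̃⁻¹ μω)²) ((1_∞, z))` for every finite idèle `z` of `L` (verbatim from #76)
    (∀ z : (FiniteAdeleRing (𝓞 L) L)ˣ,
        χf (finAdelicCheck (↥(maximalRealSubfield L)) L (IsCMField.complexConj L)
            (AlgEquiv.ext fun x => by rw [AlgEquiv.mul_apply, IsCMField.complexConj_apply_apply, AlgEquiv.one_apply]) z) =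
          (ξ.bcψ⁻¹ * (ξ.bcη⁻¹ * ξ.bcψ⁻¹ * μω) ^ 2)
            (Units.map (N := AdeleRing (𝓞 L) L) (MonoidHom.inr (InfiniteAdeleRing L) (FiniteAdeleRing (𝓞 L) L)) z)) →
    ∀ (v : HeightOneSpectrum (𝓞 ↥(maximalRealSubfield L))),
      (∀ w : PlacesOver L v, IsCMField.complexConj L • w.1 = w.1) →
      ∀ (T : GL (Fin 3) (LocalRing L v)) (a : LocalRing L v) (ha : IsUnit a)
        (h : formCongr (conjLocal L (IsCMField.complexConj L) v) T (H.map (algebraMap L (LocalRing L v))) =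
          a • (Matrix.of fun i j : Fin 3 => if i.val + j.val + 1 = 3 then (1 : L) else 0).map (algebraMap L (LocalRing L v))),
      ∀ [MeasurableSpace (Gqs L v ⧸ Subgroup.center (Gqs L v))] [BorelSpace (Gqs L v ⧸ Subgroup.center (Gqs L v))]
        (μZ : Measure (Gqs L v ⧸ Subgroup.center (Gqs L v))) [μZ.IsHaarMeasure],
      ∀ (π2 πn : IrrClass (Gqs L v)),
        KeysCaseTwoLabels L v (μω.semilocalComponent L v) (torusLocalComponent L (IsCMField.complexConj L) v ξ.η)
          (torusLocalComponent L (IsCMField.complexConj L) v ξ.ψ) π2 πn →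
        ¬ πn.IsSquareIntegrable μZ →
        ∀ (πs : IrrClass ((cmDatum L 3 H).Local v)), πs.IsSupercuspidal →
          πs ≠ IrrClass.comap (cmDatumLocalCongr L v T ha h).symm πn →
          (⟨IrrClass.comap (cmDatumLocalCongr L v T ha h).symm πn, some πs⟩ : CMLocalAPacket L H v).CharIdentityAt L H v
              (fun c f => c.smoothTrace (νG v) f) (ξloc v) (νH v) (Δ v) (mH v) (mG v) →
          ∃ ε : (↥(maximalRealSubfield L))ˣ, ThetaTypeAtCM L H e₁ dV hdV hdV0 g hg μ hμ χf ε v πs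

set_option synthInstance.maxHeartbeats 400000 in
set_option maxHeartbeats 8000000 in
/-- **The `Q`-shaped theta-docking package** (currency of ★ `CMCharIdentityPackage`): for the global data `(Δ_v, m_{H,v}, m_{G,v})_v`, the clauses
`CMThetaDockingClauses` for EVERY global character `ξ` of `H` at the local characters `ξ_v = ξ.xiLocalChar v` BY NAME, for the given frame.  Intended use: the joint
letter's owner conjoins it, `Q := fun Δ mH mG => CMCharIdentityPackage … Δ mH mG ∧ CMThetaDockingPackage … Δ mH mG`.
[cite: Rogawski1990, §13.1 Prop. 13.1.4 p. 199] [cite: GelbartRogawski1991, Lem. 5.1.2 p. 466] -/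
def CMThetaDockingPackage
    [∀ v : HeightOneSpectrum (𝓞 ↥(maximalRealSubfield L)), MeasurableSpace ((cmDatum L 3 H).Local v)]
    [∀ v : HeightOneSpectrum (𝓞 ↥(maximalRealSubfield L)),
      MeasurableSpace ((cmDatum L 2 (Matrix.of fun i j : Fin 2 => if i.val + j.val + 1 = 2 then (1 : L) else 0)).Local v ×
        (cmDatum L 1 (Matrix.of fun i j : Fin 1 => if i.val + j.val + 1 = 1 then (1 : L) else 0)).Local v)]
    [∀ (v : HeightOneSpectrum (𝓞 ↥(maximalRealSubfield L)))
        (a : ((cmDatum L 2 (Matrix.of fun i j : Fin 2 => if i.val + j.val + 1 = 2 then (1 : L) else 0)).Local v ×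
          (cmDatum L 1 (Matrix.of fun i j : Fin 1 => if i.val + j.val + 1 = 1 then (1 : L) else 0)).Local v)),
      MeasurableSpace (((cmDatum L 2 (Matrix.of fun i j : Fin 2 => if i.val + j.val + 1 = 2 then (1 : L) else 0)).Local v ×
          (cmDatum L 1 (Matrix.of fun i j : Fin 1 => if i.val + j.val + 1 = 1 then (1 : L) else 0)).Local v) ⧸
        Subgroup.centralizer ({a} : Set ((cmDatum L 2 (Matrix.of fun i j : Fin 2 => if i.val + j.val + 1 = 2 then (1 : L) else 0)).Local v ×
          (cmDatum L 1 (Matrix.of fun i j : Fin 1 => if i.val + j.val + 1 = 1 then (1 : L) else 0)).Local v)))]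
    [∀ (v : HeightOneSpectrum (𝓞 ↥(maximalRealSubfield L))) (γ : (cmDatum L 3 H).Local v),
      MeasurableSpace ((cmDatum L 3 H).Local v ⧸ Subgroup.centralizer ({γ} : Set ((cmDatum L 3 H).Local v)))]
    (νH : ∀ v : HeightOneSpectrum (𝓞 ↥(maximalRealSubfield L)),
      Measure ((cmDatum L 2 (Matrix.of fun i j : Fin 2 => if i.val + j.val + 1 = 2 then (1 : L) else 0)).Local v ×
        (cmDatum L 1 (Matrix.of fun i j : Fin 1 => if i.val + j.val + 1 = 1 then (1 : L) else 0)).Local v))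
    (νG : ∀ v : HeightOneSpectrum (𝓞 ↥(maximalRealSubfield L)), Measure ((cmDatum L 3 H).Local v))
    (μω : HeckeCharacter L)
    {n' : ℕ} (e₁ : Fin 3 × Fin 1 ≃ Fin n') (dV : Fin 3 → L) (hdV : ∀ i, IsCMField.complexConj L (dV i) = dV i) (hdV0 : ∀ i, dV i ≠ 0) (g : GL (Fin 3) L)
    (hg : ((g : Matrix (Fin 3) (Fin 3) L).map (cmConjRingHom L))ᵀ * H * (g : Matrix (Fin 3) (Fin 3) L) = Matrix.diagonal dV) :
    (∀ v : HeightOneSpectrum (𝓞 ↥(maximalRealSubfield L)), LocalTransferFactor L H v) →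
    (∀ v : HeightOneSpectrum (𝓞 ↥(maximalRealSubfield L)),
      OrbitalMeasureFamily ((cmDatum L 2 (Matrix.of fun i j : Fin 2 => if i.val + j.val + 1 = 2 then (1 : L) else 0)).Local v ×
        (cmDatum L 1 (Matrix.of fun i j : Fin 1 => if i.val + j.val + 1 = 1 then (1 : L) else 0)).Local v)) →
    (∀ v : HeightOneSpectrum (𝓞 ↥(maximalRealSubfield L)), OrbitalMeasureFamily ((cmDatum L 3 H).Local v)) → Prop :=
  fun Δ mH mG => ∀ ξ : OneDimAutRepH L, CMThetaDockingClauses L H Δ mH mG νH νG ξ μω (fun v => ξ.xiLocalChar v) e₁ dV hdV hdV0 g hg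

variable {L H}
variable
  [∀ v : HeightOneSpectrum (𝓞 ↥(maximalRealSubfield L)), MeasurableSpace ((cmDatum L 3 H).Local v)]
  [∀ v : HeightOneSpectrum (𝓞 ↥(maximalRealSubfield L)),
    MeasurableSpace ((cmDatum L 2 (Matrix.of fun i j : Fin 2 => if i.val + j.val + 1 = 2 then (1 : L) else 0)).Local v ×
      (cmDatum L 1 (Matrix.of fun i j : Fin 1 => if i.val + j.val + 1 = 1 then (1 : L) else 0)).Local v)]
  [∀ (v : HeightOneSpectrum (𝓞 ↥(maximalRealSubfield L)))
      (a : ((cmDatum L 2 (Matrix.of fun i j : Fin 2 => if i.val + j.val + 1 = 2 then (1 : L) else 0)).Local v ×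
        (cmDatum L 1 (Matrix.of fun i j : Fin 1 => if i.val + j.val + 1 = 1 then (1 : L) else 0)).Local v)),
    MeasurableSpace (((cmDatum L 2 (Matrix.of fun i j : Fin 2 => if i.val + j.val + 1 = 2 then (1 : L) else 0)).Local v ×
        (cmDatum L 1 (Matrix.of fun i j : Fin 1 => if i.val + j.val + 1 = 1 then (1 : L) else 0)).Local v) ⧸
      Subgroup.centralizer ({a} : Set ((cmDatum L 2 (Matrix.of fun i j : Fin 2 => if i.val + j.val + 1 = 2 then (1 : L) else 0)).Local v ×
        (cmDatum L 1 (Matrix.of fun i j : Fin 1 => if i.val + j.val + 1 = 1 then (1 : L) else 0)).Local v)))]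
  [∀ (v : HeightOneSpectrum (𝓞 ↥(maximalRealSubfield L))) (γ : (cmDatum L 3 H).Local v),
    MeasurableSpace ((cmDatum L 3 H).Local v ⧸ Subgroup.centralizer ({γ} : Set ((cmDatum L 3 H).Local v)))]
  {Δ : ∀ v : HeightOneSpectrum (𝓞 ↥(maximalRealSubfield L)), LocalTransferFactor L H v}
  {mH : ∀ v : HeightOneSpectrum (𝓞 ↥(maximalRealSubfield L)),
    OrbitalMeasureFamily ((cmDatum L 2 (Matrix.of fun i j : Fin 2 => if i.val + j.val + 1 = 2 then (1 : L) else 0)).Local v ×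
      (cmDatum L 1 (Matrix.of fun i j : Fin 1 => if i.val + j.val + 1 = 1 then (1 : L) else 0)).Local v)}
  {mG : ∀ v : HeightOneSpectrum (𝓞 ↥(maximalRealSubfield L)), OrbitalMeasureFamily ((cmDatum L 3 H).Local v)}
  {νH : ∀ v : HeightOneSpectrum (𝓞 ↥(maximalRealSubfield L)),
    Measure ((cmDatum L 2 (Matrix.of fun i j : Fin 2 => if i.val + j.val + 1 = 2 then (1 : L) else 0)).Local v ×
      (cmDatum L 1 (Matrix.of fun i j : Fin 1 => if i.val + j.val + 1 = 1 then (1 : L) else 0)).Local v)}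
  {νG : ∀ v : HeightOneSpectrum (𝓞 ↥(maximalRealSubfield L)), Measure ((cmDatum L 3 H).Local v)}
  {μω : HeckeCharacter L}
  {n' : ℕ} {e₁ : Fin 3 × Fin 1 ≃ Fin n'} {dV : Fin 3 → L} {hdV : ∀ i, IsCMField.complexConj L (dV i) = dV i} {hdV0 : ∀ i, dV i ≠ 0} {g : GL (Fin 3) L}
  {hg : ((g : Matrix (Fin 3) (Fin 3) L).map (cmConjRingHom L))ᵀ * H * (g : Matrix (Fin 3) (Fin 3) L) = Matrix.diagonal dV}

/-- Read-back: the package gives the clauses at every `ξ`, at `ξloc := ξ.xiLocalChar`. [cite: Rogawski1990, §13.1 Prop. 13.1.4 p. 199] -/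
theorem CMThetaDockingPackage.clauses (hQ : CMThetaDockingPackage L H νH νG μω e₁ dV hdV hdV0 g hg Δ mH mG) (ξ : OneDimAutRepH L) :
    CMThetaDockingClauses L H Δ mH mG νH νG ξ μω (fun v => ξ.xiLocalChar v) e₁ dV hdV hdV0 g hg :=
  hQ ξ

/-- Unfolding of `CMThetaDockingPackage`. [cite: Rogawski1990, §13.1 Prop. 13.1.4 p. 199] -/
theorem cmThetaDockingPackage_iff :
    CMThetaDockingPackage L H νH νG μω e₁ dV hdV hdV0 g hg Δ mH mG ↔
      ∀ ξ : OneDimAutRepH L, CMThetaDockingClauses L H Δ mH mG νH νG ξ μω (fun v => ξ.xiLocalChar v) e₁ dV hdV hdV0 g hg :=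
  Iff.rfl

end Clauses

end Literature.NumberTheory.Rogawski1990

end
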